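import Summits.SmoothPoincare4.SmoothPoincare4.Theorems.SblfDescentRungOneDefs
import Literature.Topology.FourManifolds.ImmersionCriterion
import Literature.Topology.FourManifolds.GluckTwistProofs
import Literature.Topology.FourManifolds.KnotFraming
import HarnessLib

/-!
# The fold tube is an open embedding; the transverse angle map `G`

Helper layer `helper_degree_tube` of the brick `helper_sliceGluing_vanishingDegree` (apex leaf
F0, the degree lemma) of line `Sketch`, crux `SblfDescent.RungOne`
(crux item stmt-SmoothPoincare4-18531).

For a fold tube `ν : 𝕊¹ × ℝ³ → X` of a genus-one SBLF (`IsFoldTube f v ε ν`: `C^∞`, injective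
with injective differential on `𝕊¹ × B(0, ε)`, `f ∘ ν (u, x) = (√(1 - Q²) u, v₂ Q)`,
`Q = x₀² + x₁² - x₂²`) we prove:

* `helper_degree_tube_isOpen_image` — `ν` maps open subsets of `𝕊¹ × B(0, ε)` to open subsets
  of `X` (immersion criterion + invariance of domain for immersions between `4`-manifolds,
  `ImmersionCriterion.lean`, `GluckTwistProofs.lean`), so that its inverse is continuous on the
  open tube (`helper_degree_tube_continuousOn_inv`);
* `helper_degree_tube` (registered) — **the transverse angle map**: for `0 < ε' < ε` there is
  `G : X → 𝕊¹`, continuous on `{⟪f, v⟫ < 7ε'²/8}`, equal to `circlePt (clamp (2x₂/ε'))` on the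
  `ε'`-tube (`clamp` to `[-1/2, 1/2]`) and to the antipode `circlePt (1/2)` off it.  Its winding
  number along a loop counts the signed crossings of the loop with the vanishing annuli
  `{x₂ = 0}`; it is the collar-free carrier of the degree of the loop of vanishing cycles.

## References

* K. Hayano, *On genus-1 simplified broken Lefschetz fibrations*, Algebr. Geom. Topol. 11
  (2011), Def. 2.1 (4). [Hayano2011]
* J. M. Lee, *Introduction to Smooth Manifolds*, 2nd ed. (2013), Thm. 4.12, Prop. 5.22.
  [LeeSmoothManifolds2013]
-/

set_option linter.dupNamespace false

noncomputable section

open scoped Manifold ContDiff Topology RealInnerProductSpace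
open Set Function Literature.Topology.FourManifolds

namespace Summit.SmoothPoincare4.SmoothPoincare4.Cruxes.RungOne.Sketch

attribute [local instance] Literature.Topology.FourManifolds.fact_finrank_euclideanSpace_succ

section Tube

variable {X : Type} [TopologicalSpace X] [ChartedSpace (EuclideanSpace ℝ (Fin 4)) X]
  [IsManifold (𝓡 4) ∞ X]
  {f : X → Metric.sphere (0 : EuclideanSpace ℝ (Fin 3)) 1}
  {v : Metric.sphere (0 : EuclideanSpace ℝ (Fin 3)) 1} {ε : ℝ}
  {ν : (Metric.sphere (0 : EuclideanSpace ℝ (Fin 2)) 1) × EuclideanSpace ℝ (Fin 3) → X}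

/-- **The fold tube is open**: `ν` maps open subsets of `𝕊¹ × B(0, ε)` onto open subsets of `X`
(it is a `C^∞` immersion between `4`-manifolds there). [cite: LeeSmoothManifolds2013, Thm. 4.12] -/
theorem helper_degree_tube_isOpen_image (hT : IsFoldTube f v ε ν)
    {U : Set ((Metric.sphere (0 : EuclideanSpace ℝ (Fin 2)) 1) × EuclideanSpace ℝ (Fin 3))}
    (hU : IsOpen U) (hUs : U ⊆ univ ×ˢ Metric.ball 0 ε) : IsOpen (ν '' U) := by
  rw [isOpen_iff_mem_nhds]
  rintro _ ⟨q, hq, rfl⟩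
  have hSo : IsOpen ((univ : Set (Metric.sphere (0 : EuclideanSpace ℝ (Fin 2)) 1)) ×ˢ
      Metric.ball (0 : EuclideanSpace ℝ (Fin 3)) ε) := isOpen_univ.prod Metric.isOpen_ball
  have himm : Manifold.IsImmersionAt ((𝓡 1).prod 𝓘(ℝ, EuclideanSpace ℝ (Fin 3))) (𝓡 4) ∞ ν q :=
    isImmersionAt_of_injective_mfderiv hSo (hUs hq) hT.contMDiffOn (by exact_mod_cast le_top)
      (hT.mfderiv_injective q (hUs hq).2)
  have hE : Module.finrank ℝ (EuclideanSpace ℝ (Fin 1) × EuclideanSpace ℝ (Fin 3)) =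
      Module.finrank ℝ (EuclideanSpace ℝ (Fin 4)) := by
    simp [Module.finrank_prod]
  exact Literature.Topology.FourManifolds.Manifold.IsImmersionAt.image_mem_nhds_of_finrank_eq himm hE
    (hU.mem_nhds hq)

/-- **The inverse of the fold tube is continuous on the open tube.**
[cite: LeeSmoothManifolds2013, Prop. 5.22] -/
theorem helper_degree_tube_continuousOn_inv (hT : IsFoldTube f v ε ν) :
    ContinuousOn (invFunOn ν (univ ×ˢ Metric.ball 0 ε)) (ν '' (univ ×ˢ Metric.ball 0 ε)) := by
  set S : Set ((Metric.sphere (0 : EuclideanSpace ℝ (Fin 2)) 1) × EuclideanSpace ℝ (Fin 3)) :=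
    univ ×ˢ Metric.ball 0 ε with hS
  have hSo : IsOpen S := isOpen_univ.prod Metric.isOpen_ball
  have hleft : ∀ q ∈ S, invFunOn ν S (ν q) = q := fun q hq => hT.injOn.leftInvOn_invFunOn hq
  rw [continuousOn_iff']
  intro V hV
  refine ⟨ν '' (V ∩ S), helper_degree_tube_isOpen_image hT (hV.inter hSo) inter_subset_right, ?_⟩
  ext p
  constructor
  · rintro ⟨hpV, ⟨q, hq, rfl⟩⟩
    refine ⟨⟨q, ⟨?_, hq⟩, rfl⟩, ⟨q, hq, rfl⟩⟩
    rw [mem_preimage, hleft q hq] at hpV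
    exact hpV
  · rintro ⟨⟨q, ⟨hqV, hqS⟩, rfl⟩, -⟩
    refine ⟨?_, ⟨q, hqS, rfl⟩⟩
    rw [mem_preimage, hleft q hqS]
    exact hqV

omit [IsManifold (𝓡 4) ∞ X] in
/-- In the tube the height `v₂ f₂` is the quadratic form `Q = x₀² + x₁² - x₂²` (the pole is
`v = (0, 0, ±1)`). [cite: Hayano2011, Def. 2.1 (4)] -/
theorem helper_degree_tube_height (hT : IsFoldTube f v ε ν)
    (hv0 : (v : EuclideanSpace ℝ (Fin 3)) 0 = 0) (hv1 : (v : EuclideanSpace ℝ (Fin 3)) 1 = 0)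
    (u : Metric.sphere (0 : EuclideanSpace ℝ (Fin 2)) 1) {y : EuclideanSpace ℝ (Fin 3)}
    (hy : y ∈ Metric.ball (0 : EuclideanSpace ℝ (Fin 3)) ε) :
    (v : EuclideanSpace ℝ (Fin 3)) 2 *
        ((f (ν (u, y)) : Metric.sphere (0 : EuclideanSpace ℝ (Fin 3)) 1) : EuclideanSpace ℝ (Fin 3)) 2 =
      y 0 ^ 2 + y 1 ^ 2 - y 2 ^ 2 := by
  have hv2 : (v : EuclideanSpace ℝ (Fin 3)) 2 ^ 2 = 1 := by
    have hn := norm_eq_of_mem_sphere v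
    have : ‖(v : EuclideanSpace ℝ (Fin 3))‖ ^ 2 = 1 := by rw [hn]; norm_num
    rw [EuclideanSpace.norm_eq, Real.sq_sqrt (Finset.sum_nonneg fun i _ => by positivity),
      Fin.sum_univ_three] at this
    simpa [hv0, hv1] using this
  rw [(hT.formula u y hy).2.2, ← mul_assoc, ← sq, hv2, one_mul]

/-- `circlePt (-1/2) = circlePt (1/2)` (the antipode of the base point). [folklore] -/
theorem helper_degree_circlePt_neg_half : circlePt (-1 / 2) = circlePt (1 / 2) := by
  rw [show (1 / 2 : ℝ) = -1 / 2 + (1 : ℤ) by norm_num]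
  exact (circlePt_add_int _ _).symm

end Tube

/-- **The transverse angle map of the fold tube** (registered layer D of the degree lemma
`helper_sliceGluing_vanishingDegree`).  For `0 < ε' < ε` there is `G : X → 𝕊¹`, continuous on
the region `{v₂ f₂ < 7ε'²/8}` (which contains the sphere side, the round locus and the low torus
levels), equal to `circlePt (clamp_{[-1/2,1/2]} (2x₂/ε'))` at `ν (u, x)`, `‖x‖ < ε'`, and to the
antipode `circlePt (1/2)` off the `ε'`-tube: the standard angle of the transverse coordinate
`x₂` of the vanishing annuli, collapsed to a point away from them.  (Continuity across the edge
of the tube: a point of the closed `ε'`-tube with `|x₂| ≤ ε'/4` on its boundary sphere has height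
`Q = ε'² - 2x₂² ≥ 7ε'²/8`.) [cite: Hayano2011, Def. 2.1 (4)] -/
theorem helper_degree_tube : ∀ (X : Type) [TopologicalSpace X] [T2Space X] [ChartedSpace (EuclideanSpace ℝ (Fin 4)) X] [IsManifold (𝓡 4) ∞ X] (f : X → Metric.sphere (0 : EuclideanSpace ℝ (Fin 3)) 1) (v : Metric.sphere (0 : EuclideanSpace ℝ (Fin 3)) 1), (v : EuclideanSpace ℝ (Fin 3)) 0 = 0 → (v : EuclideanSpace ℝ (Fin 3)) 1 = 0 → ∀ (ε : ℝ) (ν : (Metric.sphere (0 : EuclideanSpace ℝ (Fin 2)) 1) × EuclideanSpace ℝ (Fin 3) → X), IsFoldTube f v ε ν → ∀ (ε' : ℝ), 0 < ε' → ε' < ε → ∃ G : X → Metric.sphere (0 : EuclideanSpace ℝ (Fin 2)) 1, ContinuousOn G {p : X | (v : EuclideanSpace ℝ (Fin 3)) 2 * ((f p : Metric.sphere (0 : EuclideanSpace ℝ (Fin 3)) 1) : EuclideanSpace ℝ (Fin 3)) 2 < 7 * ε' ^ 2 / 8} ∧ (∀ (u : Metric.sphere (0 : EuclideanSpace ℝ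 (Fin 2)) 1) (y : EuclideanSpace ℝ (Fin 3)), y ∈ Metric.ball (0 : EuclideanSpace ℝ (Fin 3)) ε' → G (ν (u, y)) = circlePt (max (-1 / 2) (min (1 / 2) (2 * y 2 / ε')))) ∧ (∀ p : X, p ∉ ν '' (Set.univ ×ˢ Metric.ball (0 : EuclideanSpace ℝ (Fin 3)) ε') → G p = circlePt (1 / 2)) := by
  intro X _ _ _ _ f v hv0 hv1 ε ν hT ε' hε' hε'ε
  classical
  -- the open `ε'`-tube, the inverse of `ν`, and the formula on the tube
  set S : Set ((Metric.sphere (0 : EuclideanSpace ℝ (Fin 2)) 1) × EuclideanSpace ℝ (Fin 3)) :=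
    univ ×ˢ Metric.ball 0 ε with hS
  set S' : Set ((Metric.sphere (0 : EuclideanSpace ℝ (Fin 2)) 1) × EuclideanSpace ℝ (Fin 3)) :=
    univ ×ˢ Metric.ball 0 ε' with hS'
  have hS'S : S' ⊆ S := prod_mono Subset.rfl (Metric.ball_subset_ball hε'ε.le)
  have hS'o : IsOpen S' := isOpen_univ.prod Metric.isOpen_ball
  set T' : Set X := ν '' S' with hT'
  have hT'o : IsOpen T' := helper_degree_tube_isOpen_image hT hS'o hS'S
  set νinv := invFunOn ν S with hνinv
  have hleft : ∀ q ∈ S, νinv (ν q) = q := fun q hq => hT.injOn.leftInvOn_invFunOn hq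
  set g : EuclideanSpace ℝ (Fin 3) → ℝ := fun y => max (-1 / 2) (min (1 / 2) (2 * y 2 / ε')) with hg
  have hgc : Continuous g := continuous_const.max (continuous_const.min
    ((continuous_const.mul ((EuclideanSpace.proj (2 : Fin 3)).continuous)).div_const _))
  set Gt : X → Metric.sphere (0 : EuclideanSpace ℝ (Fin 2)) 1 := fun p => circlePt (g (νinv p).2)
    with hGt
  have hGtc : ContinuousOn Gt T' :=
    (continuous_circlePt.comp (hgc.comp continuous_snd)).comp_continuousOn
      ((helper_degree_tube_continuousOn_inv hT).mono (image_mono hS'S))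
  set p₀ : Metric.sphere (0 : EuclideanSpace ℝ (Fin 2)) 1 := circlePt (1 / 2) with hp₀
  set G : X → Metric.sphere (0 : EuclideanSpace ℝ (Fin 2)) 1 := fun p => if p ∈ T' then Gt p else p₀
    with hG
  have hG_in : ∀ p ∈ T', G p = Gt p := fun p hp => by rw [hG]; simp only; rw [if_pos hp]
  have hG_out : ∀ p ∉ T', G p = p₀ := fun p hp => by rw [hG]; simp only; rw [if_neg hp]
  have hG_tube : ∀ (u : Metric.sphere (0 : EuclideanSpace ℝ (Fin 2)) 1) (y : EuclideanSpace ℝ (Fin 3)),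
      y ∈ Metric.ball (0 : EuclideanSpace ℝ (Fin 3)) ε' → G (ν (u, y)) = circlePt (g y) := by
    intro u y hy
    have hq : (u, y) ∈ S' := ⟨mem_univ _, hy⟩
    rw [hG_in _ ⟨(u, y), hq, rfl⟩, hGt]
    simp only
    rw [hleft _ (hS'S hq)]
  -- off the core `ν (𝕊¹ × {‖y‖ < ε', |y₂| < ε'/4})` the map is the constant `p₀`
  set K : Set ((Metric.sphere (0 : EuclideanSpace ℝ (Fin 2)) 1) × EuclideanSpace ℝ (Fin 3)) :=
    univ ×ˢ (Metric.closedBall 0 ε' ∩ {y | |y 2| ≤ ε' / 4}) with hK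
  have hKS : K ⊆ S := fun q hq =>
    ⟨mem_univ _, Metric.mem_ball.2 (lt_of_le_of_lt (Metric.mem_closedBall.1 hq.2.1) hε'ε)⟩
  have hKc : IsCompact K := isCompact_univ.prod ((isCompact_closedBall _ _).inter_right
    (isClosed_le (continuous_abs.comp (EuclideanSpace.proj (2 : Fin 3)).continuous) continuous_const))
  have hνKc : IsCompact (ν '' K) := hKc.image_of_continuousOn (hT.contMDiffOn.continuousOn.mono hKS)
  have hνKcl : IsClosed (ν '' K) := hνKc.isClosed
  have hG_const : ∀ p ∉ ν '' K, G p = p₀ := by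
    intro p hp
    by_cases hpT : p ∈ T'
    · obtain ⟨⟨u, y⟩, ⟨-, hy⟩, rfl⟩ := hpT
      rw [hG_tube u y hy]
      -- here `|y₂| > ε'/4`, so the clamp saturates
      have hy2 : ε' / 4 < |y 2| := by
        by_contra hle
        exact hp ⟨(u, y), ⟨mem_univ _, Metric.mem_closedBall.2 (Metric.mem_ball.1 hy).le,
          not_lt.1 hle⟩, rfl⟩
      rcases lt_abs.1 hy2 with h | h
      · have : g y = 1 / 2 := by
          rw [hg]; simp only
          rw [min_eq_left (by rw [le_div_iff₀ hε']; linarith), max_eq_right (by norm_num)]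
        rw [this]
      · have : g y = -1 / 2 := by
          rw [hg]; simp only
          rw [min_eq_right (by rw [div_le_iff₀ hε']; linarith), max_eq_left (by
            rw [div_le_iff₀ hε']; linarith)]
        rw [this, hp₀, helper_degree_circlePt_neg_half]
    · exact hG_out p hpT
  refine ⟨G, ?_, fun u y hy => hG_tube u y hy, fun p hp => hG_out p hp⟩
  -- continuity on `{v₂ f₂ < 7ε'²/8}`
  intro p hp
  by_cases hpT : p ∈ T'
  · have h1 : ContinuousAt Gt p := (hGtc p hpT).continuousAt (hT'o.mem_nhds hpT)
    refine (h1.congr ?_).continuousWithinAt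
    filter_upwards [hT'o.mem_nhds hpT] with q hq using (hG_in q hq).symm
  · -- `p` is off the compact `ν '' K`: else `p = ν (u, y)` with `‖y‖ = ε'`, `|y₂| ≤ ε'/4`
    have hpK : p ∉ ν '' K := by
      rintro ⟨⟨u, y⟩, ⟨-, hyb, hy2⟩, rfl⟩
      have hyε : y ∈ Metric.ball (0 : EuclideanSpace ℝ (Fin 3)) ε :=
        Metric.mem_ball.2 (lt_of_le_of_lt (Metric.mem_closedBall.1 hyb) hε'ε)
      have hnorm : ‖y‖ = ε' := by
        refine le_antisymm (mem_closedBall_zero_iff.1 hyb) (not_lt.1 fun hlt => hpT ?_)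
        exact ⟨(u, y), ⟨mem_univ _, mem_ball_zero_iff.2 hlt⟩, rfl⟩
      have hh := helper_degree_tube_height hT hv0 hv1 u hyε
      rw [mem_setOf_eq, hh] at hp
      have hsq : ‖y‖ ^ 2 = y 0 ^ 2 + y 1 ^ 2 + y 2 ^ 2 := by
        rw [EuclideanSpace.norm_sq_eq, Fin.sum_univ_three]; simp [sq_abs]
      rw [hnorm] at hsq
      have hy2sq : y 2 ^ 2 ≤ (ε' / 4) ^ 2 := by
        rw [← sq_abs]; exact pow_le_pow_left₀ (abs_nonneg _) hy2 2
      nlinarith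
    have hopen : IsOpen (ν '' K)ᶜ := hνKcl.isOpen_compl
    refine ((continuousAt_const : ContinuousAt (fun _ : X => p₀) p).congr ?_).continuousWithinAt
    filter_upwards [hopen.mem_nhds hpK] with q hq using (hG_const q hq).symm

end Summit.SmoothPoincare4.SmoothPoincare4.Cruxes.RungOne.Sketch

end
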